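import Summits.RiemannHypothesis.RiemannHypothesis.Theses.OddSector
import Summits.RiemannHypothesis.RiemannHypothesis.Theorems.WeilGroundStateGroundStatesConvergeToXiEulerLagrange
import Literature.NumberTheory.LFunctions.WeilOddGroundState
import Literature.NumberTheory.LFunctions.WeilGroundEnergyParitySplit
import HarnessLib

/-!
# The weak Euler–Lagrange equation of an odd-sector Weil ground state
(helper for crux `OddSector.OddOneSignedWindows`, item stmt-RiemannHypothesis-17778; RH-free)

An odd-sector ground state of Weil's windowed quadratic form is encoded in the tree WITHOUT an
operator (`Literature.NumberTheory.LFunctions.IsWeilOddGroundState a u`): `u ∈ L²` is the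
`L²`-limit of an `L²`-normalised minimising sequence `gₙ` of ODD window test functions,
`Re Q(gₙ) → ε_od(a) = weilOddGroundEnergy a`. Every position-space statement about the SIGN of
`u` on `(0, a)` — the content of the crux `OddOneSignedWindows`, and of the Barta argument of
`OddBartaFloor` — starts from the first-order condition of minimality, Bombieri's variational
equation (Bombieri 2000, §4 Lemma 1 / (4.2) `λ f = L[f]`) in the odd sector. This file proves
it in the form the encoding allows, in WEAK form ALONG THE MINIMISING SEQUENCE and against EVERY
window test function:

* `oddGroundState_eulerLagrange` — for every window test function `h`,
  `W(gₙ ⋆ h̃) → ε_od(a) · ⟨u, h⟩ = ε_od(a) ∫ u h̄`;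
* `IsWeilOddGroundState.exists_eulerLagrange` — the packaged form.

It is the odd-sector twin of `groundState_eulerLagrange`
(Theorems/WeilGroundStateGroundStatesConvergeToXiEulerLagrange.lean, route WeilGroundState),
whose hypothesis-free polarisation lemmas are reused. What changes: the shifted form
`q = Re Q − ε_od(a)‖·‖²` is non-negative only on ODD window tests, so the Cauchy–Schwarz bound on
its polar form (`abs_polar_le_odd`) and the vanishing of the polar defect along the sequence
(`tendsto_polarDefect_of_oddMinimizingSeq`) are first obtained for odd test directions `h`; an
even direction pairs trivially with the odd data (`W(gₙ ⋆ h̃) = 0` by parity,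
`weilFunctional_weilConv_weilReflect_eq_zero_of_odd_even`, and `∫ u h̄ = 0` since `u` is odd
a.e.), and a general `h` is split into its even and odd parts.

References: E. Bombieri, Rend. Lincei (9) 11 (2000), §4 (Problem 2, Lemma 1, (4.2), Thm 3,
Thm 5) and §9 Lemma 11 (even/odd eigenfunctions); H. Yoshida (1992) §2.
-/

noncomputable section

set_option linter.dupNamespace false

open scoped Topology Real ComplexConjugate
open Filter Set MeasureTheory Complex

namespace Summit.RiemannHypothesis.RiemannHypothesis.Theorems.OddSector

open Literature.NumberTheory.LFunctions
open Summit.RiemannHypothesis.RiemannHypothesis.Theorems.GroundStatesConvergeToXi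

/-! ### Cauchy–Schwarz for the shifted form in the odd sector -/

/-- Sums of odd functions with real multiples of odd functions are odd. [folklore] -/
theorem odd_add_real_mul {f h : ℝ → ℂ} (hfo : ∀ t, f (-t) = -f t) (hho : ∀ t, h (-t) = -h t)
    (s : ℝ) : ∀ t, (f + fun x ↦ (s : ℂ) * h x) (-t) = -(f + fun x ↦ (s : ℂ) * h x) t := by
  intro t
  simp only [Pi.add_apply, hfo t, hho t]
  ring

/-- **Cauchy–Schwarz for the shifted form on the odd sector.** For ODD test functions `f, h`
on the window `[-a, a]` put `q(φ) := Re Q(φ) − ε_od(a)∫|φ|²` (`≥ 0` on odd window tests,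
`weilOddGroundEnergy_mul_le_re`). Then `|q(f + h) − q(f) − q(h)| ≤ 2 √q(f) √q(h)`: the real
polynomial `t ↦ q(f + t h) ≥ 0` (each `f + t h` is an odd window test) has non-positive
discriminant. [cite: Bombieri2000Weil, §4 Problem 2, Thm 3 (proof) and Thm 5] -/
theorem abs_polar_le_odd {a : ℝ} {f h : ℝ → ℂ} (hf : IsWeilTest f)
    (hfs : tsupport f ⊆ Icc (-a) a) (hfo : ∀ t, f (-t) = -f t) (hh : IsWeilTest h)
    (hhs : tsupport h ⊆ Icc (-a) a) (hho : ∀ t, h (-t) = -h t) :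
    |((weilQuadratic (f + h)).re - weilOddGroundEnergy a * ∫ x, ‖(f + h) x‖ ^ 2) -
        ((weilQuadratic f).re - weilOddGroundEnergy a * ∫ x, ‖f x‖ ^ 2) -
        ((weilQuadratic h).re - weilOddGroundEnergy a * ∫ x, ‖h x‖ ^ 2)| ≤
      2 * Real.sqrt ((weilQuadratic f).re - weilOddGroundEnergy a * ∫ x, ‖f x‖ ^ 2) *
        Real.sqrt ((weilQuadratic h).re - weilOddGroundEnergy a * ∫ x, ‖h x‖ ^ 2) := by
  -- adapted from `ConnesVanSuijlekom.abs_polar_le` (WeilGroundStateRealZerosProofs.lean), ε ↦ ε_od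
  set e := weilOddGroundEnergy a with he
  set qf := (weilQuadratic f).re - e * ∫ x, ‖f x‖ ^ 2 with hqf
  set qh := (weilQuadratic h).re - e * ∫ x, ‖h x‖ ^ 2 with hqh
  set X := (weilFunctional (weilConv f (weilReflect h)) +
    weilFunctional (weilConv h (weilReflect f))).re with hX
  set P := (∫ x, f x * conj (h x)).re with hP
  set ρ := X - 2 * e * P with hρ
  have hqf0 : 0 ≤ qf := by
    have := weilOddGroundEnergy_mul_le_re hf hfs hfo
    simp only [hqf]; linarith
  have hqh0 : 0 ≤ qh := by
    have := weilOddGroundEnergy_mul_le_re hh hhs hho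
    simp only [hqh]; linarith
  have hline : ∀ t : ℝ,
      (weilQuadratic (f + fun x ↦ (t : ℂ) * h x)).re -
          e * ∫ x, ‖(f + fun x ↦ (t : ℂ) * h x) x‖ ^ 2 =
        qf + t ^ 2 * qh + t * ρ := by
    intro t
    rw [ConnesVanSuijlekom.re_weilQuadratic_add_real_mul hf hh t,
      ConnesVanSuijlekom.integral_norm_sq_add_real_mul hf hh t]
    simp only [hqf, hqh, hρ, hX, hP]
    ring
  have hnonneg : ∀ t : ℝ, 0 ≤ qh * (t * t) + ρ * t + qf := by
    intro t
    have ht : IsWeilTest (f + fun x ↦ (t : ℂ) * h x) := hf.add (hh.const_mul t)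
    have hts : tsupport (f + fun x ↦ (t : ℂ) * h x) ⊆ Icc (-a) a :=
      (tsupport_add _ _).trans (union_subset hfs (tsupport_mul_subset_right.trans hhs))
    have h0 := weilOddGroundEnergy_mul_le_re ht hts (odd_add_real_mul hfo hho t)
    have h1 := hline t
    nlinarith [h0, h1]
  have hdisc : discrim qh ρ qf ≤ 0 := discrim_le_zero hnonneg
  rw [discrim] at hdisc
  have hone : (f + fun x ↦ ((1 : ℝ) : ℂ) * h x) = f + h := by
    funext x; simp
  have h1 := hline 1
  rw [hone] at h1
  have hval : ((weilQuadratic (f + h)).re - e * ∫ x, ‖(f + h) x‖ ^ 2) - qf - qh = ρ := by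
    rw [h1]; ring
  rw [hval]
  have hρ2 : ρ ^ 2 ≤ (2 * Real.sqrt qf * Real.sqrt qh) ^ 2 := by
    rw [mul_pow, mul_pow, Real.sq_sqrt hqf0, Real.sq_sqrt hqh0]
    nlinarith [hdisc]
  exact abs_le_of_sq_le_sq' hρ2 (by positivity) |>.elim (fun h1 h2 ↦ abs_le.2 ⟨h1, h2⟩)

/-! ### The polar defect vanishes along an odd minimising sequence -/

/-- **The real polar defect vanishes in the limit (odd sector).** Let `gₙ` be `L²`-normalised
ODD window test functions with `Re Q(gₙ) → ε_od(a)`. Then for every ODD window test function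
`k`, `Re(W(gₙ ⋆ k̃) + W(k ⋆ g̃ₙ)) − 2 ε_od(a) Re ∫ gₙ k̄ → 0` (the polar form of the shifted form
`q = Re Q − ε_od(a)‖·‖²`, bounded by `2 √q(gₙ) √q(k)` with `q(gₙ) → 0`).
[cite: Bombieri2000Weil, §4 Lemma 1 and Thm 3 (proof)] -/
theorem tendsto_polarDefect_of_oddMinimizingSeq {a : ℝ} {g : ℕ → ℝ → ℂ}
    (hg : ∀ n, IsWeilTest (g n) ∧ tsupport (g n) ⊆ Icc (-a) a ∧ (∀ t, g n (-t) = -g n t) ∧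
      ∫ t, ‖g n t‖ ^ 2 = (1 : ℝ))
    (hQ : Tendsto (fun n => (weilQuadratic (g n)).re) atTop (𝓝 (weilOddGroundEnergy a)))
    {k : ℝ → ℂ} (hk : IsWeilTest k) (hks : tsupport k ⊆ Icc (-a) a) (hko : ∀ t, k (-t) = -k t) :
    Tendsto (fun n => (weilFunctional (weilConv (g n) (weilReflect k)) +
        weilFunctional (weilConv k (weilReflect (g n)))).re -
      2 * weilOddGroundEnergy a * (∫ t, g n t * conj (k t)).re) atTop (𝓝 0) := by
  -- adapted from `tendsto_polarDefect_of_minimizingSeq` (even-sector file), ε ↦ ε_od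
  set ε := weilOddGroundEnergy a with hε
  have hq : Tendsto (fun n => (weilQuadratic (g n)).re - ε * ∫ t, ‖g n t‖ ^ 2) atTop (𝓝 0) := by
    have hfun : (fun n => (weilQuadratic (g n)).re - ε * ∫ t, ‖g n t‖ ^ 2) =
        fun n => (weilQuadratic (g n)).re - ε := by
      funext n
      rw [(hg n).2.2.2, mul_one]
    rw [hfun]
    have := hQ.sub_const ε
    rwa [sub_self] at this
  set qk : ℝ := (weilQuadratic k).re - ε * ∫ t, ‖k t‖ ^ 2 with hqk
  have hbound : ∀ n, |(weilFunctional (weilConv (g n) (weilReflect k)) +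
        weilFunctional (weilConv k (weilReflect (g n)))).re -
      2 * ε * (∫ t, g n t * conj (k t)).re| ≤
      2 * Real.sqrt ((weilQuadratic (g n)).re - ε * ∫ t, ‖g n t‖ ^ 2) * Real.sqrt qk := by
    intro n
    have hcs := abs_polar_le_odd (hg n).1 (hg n).2.1 (hg n).2.2.1 hk hks hko
    have e1 := ConnesVanSuijlekom.re_weilQuadratic_add_real_mul (hg n).1 hk 1
    have e2 := ConnesVanSuijlekom.integral_norm_sq_add_real_mul (hg n).1 hk 1
    have hone : (g n + fun x => ((1 : ℝ) : ℂ) * k x) = g n + k := by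
      funext x
      simp
    rw [hone] at e1 e2
    have key : ((weilQuadratic (g n + k)).re - ε * ∫ x, ‖(g n + k) x‖ ^ 2) -
        ((weilQuadratic (g n)).re - ε * ∫ x, ‖g n x‖ ^ 2) -
        ((weilQuadratic k).re - ε * ∫ x, ‖k x‖ ^ 2) =
        (weilFunctional (weilConv (g n) (weilReflect k)) +
            weilFunctional (weilConv k (weilReflect (g n)))).re -
          2 * ε * (∫ t, g n t * conj (k t)).re := by
      rw [e1, e2]
      ring
    rw [← key]
    exact hcs
  have hsq : Tendsto (fun n => 2 * Real.sqrt ((weilQuadratic (g n)).re - ε * ∫ t, ‖g n t‖ ^ 2) *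
      Real.sqrt qk) atTop (𝓝 0) := by
    have := (hq.sqrt.const_mul 2).mul_const (Real.sqrt qk)
    simpa using this
  exact squeeze_zero_norm (fun n => by rw [Real.norm_eq_abs]; exact hbound n) hsq

/-! ### The weak Euler–Lagrange equation: odd directions, even directions, all directions -/

/-- **Weak Euler–Lagrange equation against ODD window tests.** Let `gₙ` be `L²`-normalised odd
window tests with `Re Q(gₙ) → ε_od(a)`, converging in `L²` to `u ∈ L²`. Then for every ODD
window test `h`, `W(gₙ ⋆ h̃) → ε_od(a) ∫ u h̄` (real parts from the polar defect and hermitian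
symmetry `W(h ⋆ g̃) = conj W(g ⋆ h̃)`; imaginary parts from the odd direction `i h`;
`⟨gₙ, h⟩ → ⟨u, h⟩`). [cite: Bombieri2000Weil, §4 Lemma 1 / (4.2) and §9 Lemma 11] -/
theorem oddGroundState_eulerLagrange_odd {a : ℝ} {u : ℝ → ℂ} {g : ℕ → ℝ → ℂ}
    (hg : ∀ n, IsWeilTest (g n) ∧ tsupport (g n) ⊆ Icc (-a) a ∧ (∀ t, g n (-t) = -g n t) ∧
      ∫ t, ‖g n t‖ ^ 2 = (1 : ℝ))
    (hQ : Tendsto (fun n => (weilQuadratic (g n)).re) atTop (𝓝 (weilOddGroundEnergy a)))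
    (hu : MemLp u 2) (hL : Tendsto (fun n => ∫ t, ‖g n t - u t‖ ^ 2) atTop (𝓝 0))
    {h : ℝ → ℂ} (hh : IsWeilTest h) (hhs : tsupport h ⊆ Icc (-a) a) (hho : ∀ t, h (-t) = -h t) :
    Tendsto (fun n => weilFunctional (weilConv (g n) (weilReflect h))) atTop
      (𝓝 ((weilOddGroundEnergy a : ℂ) * ∫ t, u t * conj (h t))) := by
  -- adapted from `groundState_eulerLagrange` (even-sector file), ε ↦ ε_od, odd directions
  set ε := weilOddGroundEnergy a with hε
  set A : ℕ → ℂ := fun n => weilFunctional (weilConv (g n) (weilReflect h)) with hA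
  set P : ℕ → ℂ := fun n => ∫ t, g n t * conj (h t) with hP
  have hre : Tendsto (fun n => (A n).re - ε * (P n).re) atTop (𝓝 0) := by
    have h1 := tendsto_polarDefect_of_oddMinimizingSeq hg hQ hh hhs hho
    have hfun : (fun n => (weilFunctional (weilConv (g n) (weilReflect h)) +
        weilFunctional (weilConv h (weilReflect (g n)))).re -
        2 * weilOddGroundEnergy a * (∫ t, g n t * conj (h t)).re) =
        fun n => 2 * ((A n).re - ε * (P n).re) := by
      funext n
      rw [weilFunctional_weilConv_weilReflect_swap (g n) h]
      simp only [hA, hP, Complex.add_re, Complex.conj_re]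
      ring
    rw [hfun] at h1
    have h2 := h1.const_mul (1 / 2 : ℝ)
    simpa using h2
  have him : Tendsto (fun n => (A n).im - ε * (P n).im) atTop (𝓝 0) := by
    have hIh : IsWeilTest fun t => I * h t := hh.const_mul I
    have hIhs : tsupport (fun t => I * h t) ⊆ Icc (-a) a := tsupport_mul_subset_right.trans hhs
    have hIho : ∀ t, (fun t => I * h t) (-t) = -(fun t => I * h t) t := fun t ↦ by
      simp only [hho t, mul_neg]
    have h1 := tendsto_polarDefect_of_oddMinimizingSeq hg hQ hIh hIhs hIho
    have hfun : (fun n => (weilFunctional (weilConv (g n) (weilReflect fun t => I * h t)) +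
        weilFunctional (weilConv (fun t => I * h t) (weilReflect (g n)))).re -
        2 * weilOddGroundEnergy a * (∫ t, g n t * conj (I * h t)).re) =
        fun n => 2 * ((A n).im - ε * (P n).im) := by
      funext n
      rw [weilFunctional_weilConv_weilReflect_swap (g n) (fun t => I * h t),
        weilFunctional_weilConv_weilReflect_I_mul, integral_mul_conj_I_mul]
      simp only [hA, hP, Complex.add_re, Complex.conj_re, Complex.mul_re, Complex.neg_re,
        Complex.neg_im, Complex.I_re, Complex.I_im]
      ring
    rw [hfun] at h1
    have h2 := h1.const_mul (1 / 2 : ℝ)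
    simpa using h2
  have hD : Tendsto (fun n => A n - (ε : ℂ) * P n) atTop (𝓝 0) := by
    refine squeeze_zero_norm (fun n => Complex.norm_le_abs_re_add_abs_im _) ?_
    have h3 := hre.abs.add him.abs
    simp only [abs_zero, add_zero] at h3
    refine h3.congr fun n => ?_
    simp only [Complex.sub_re, Complex.sub_im, Complex.re_ofReal_mul, Complex.im_ofReal_mul]
  have hPlim : Tendsto P atTop (𝓝 (∫ t, u t * conj (h t))) := by
    have h4 := ConnesVanSuijlekom.tendsto_integral_mul_conj (ConnesVanSuijlekom.isWeilTest_memLp hh)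
      hu (fun m => ConnesVanSuijlekom.isWeilTest_memLp (hg m).1) hL
    have h5 := (Complex.continuous_conj.tendsto _).comp h4
    have hconj : ∀ v : ℝ → ℂ, conj (∫ t, h t * conj (v t)) = ∫ t, v t * conj (h t) := by
      intro v
      rw [← integral_conj]
      congr 1 with t
      simp only [map_mul, Complex.conj_conj]
      exact mul_comm _ _
    have h6 : (fun m => conj (∫ t, h t * conj (g m t))) = P := by
      funext m
      exact hconj (g m)
    rw [Function.comp_def, h6, hconj u] at h5
    exact h5
  have hsum := hD.add (hPlim.const_mul (ε : ℂ))
  rw [zero_add] at hsum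
  refine hsum.congr fun n => ?_
  simp only [hA, hP]
  ring

/-- **Even directions pair trivially with odd data.** If `g` is odd and `h` is even then
`W(g ⋆ h̃) = 0` (parity, `weilFunctional_weilConv_weilReflect_eq_zero_of_odd_even`), and if
`u` is odd a.e. then `∫ u h̄ = 0` (substitute `t ↦ -t`). [folklore] -/
theorem integral_mul_conj_eq_zero_of_ae_odd_even {u h : ℝ → ℂ} (huo : ∀ᵐ t : ℝ, u (-t) = -u t)
    (hhe : ∀ t, h (-t) = h t) : ∫ t, u t * conj (h t) = 0 := by
  have h1 : ∫ t, u (-t) * conj (h (-t)) = ∫ t, u t * conj (h t) :=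
    integral_neg_eq_self (fun t ↦ u t * conj (h t)) volume
  have h2 : ∫ t, u (-t) * conj (h (-t)) = -∫ t, u t * conj (h t) := by
    rw [← integral_neg]
    refine integral_congr_ae ?_
    filter_upwards [huo] with t ht
    rw [ht, hhe t, neg_mul]
  have h3 : ∫ t, u t * conj (h t) = -∫ t, u t * conj (h t) := h1.symm.trans h2
  have h4 : (2 : ℂ) * ∫ t, u t * conj (h t) = 0 := by linear_combination h3
  simpa using h4

/-- **Weak Euler–Lagrange equation of an odd-sector ground state, against EVERY window test.**
Let `gₙ` be `L²`-normalised odd window tests with `Re Q(gₙ) → ε_od(a)` converging in `L²` to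
`u ∈ L²`. Then for every test function `h` supported in `[-a, a]`,
`W(gₙ ⋆ h̃) → ε_od(a) · ∫ u h̄`. Proof: split `h = hₑ + hₒ` into even and odd parts (window
tests, `tsupport_subset_Icc_of_symm`); the odd part is `oddGroundState_eulerLagrange_odd`; the
even part contributes `0` to both sides (`W(gₙ ⋆ h̃ₑ) = 0` by parity and `∫ u h̄ₑ = 0` since
`u` is odd a.e., `ae_neg_eq_neg_of_tendsto`). [cite: Bombieri2000Weil, §4 Lemma 1 / (4.2) and §9 Lemma 11] -/
theorem oddGroundState_eulerLagrange {a : ℝ} {u : ℝ → ℂ} {g : ℕ → ℝ → ℂ}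
    (hg : ∀ n, IsWeilTest (g n) ∧ tsupport (g n) ⊆ Icc (-a) a ∧ (∀ t, g n (-t) = -g n t) ∧
      ∫ t, ‖g n t‖ ^ 2 = (1 : ℝ))
    (hQ : Tendsto (fun n => (weilQuadratic (g n)).re) atTop (𝓝 (weilOddGroundEnergy a)))
    (hu : MemLp u 2) (hL : Tendsto (fun n => ∫ t, ‖g n t - u t‖ ^ 2) atTop (𝓝 0))
    {h : ℝ → ℂ} (hh : IsWeilTest h) (hhs : tsupport h ⊆ Icc (-a) a) :
    Tendsto (fun n => weilFunctional (weilConv (g n) (weilReflect h))) atTop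
      (𝓝 ((weilOddGroundEnergy a : ℂ) * ∫ t, u t * conj (h t))) := by
  -- even / odd parts of `h`
  set he : ℝ → ℂ := fun t ↦ (h t + h (-t)) / 2 with hedef
  set ho : ℝ → ℂ := fun t ↦ (h t - h (-t)) / 2 with hodef
  have het : IsWeilTest he := hh.evenPart
  have hot : IsWeilTest ho := hh.oddPart
  have hes : tsupport he ⊆ Icc (-a) a :=
    tsupport_subset_Icc_of_symm hhs fun s h0 h1 ↦ by simp [hedef, h0, h1]
  have hos : tsupport ho ⊆ Icc (-a) a :=
    tsupport_subset_Icc_of_symm hhs fun s h0 h1 ↦ by simp [hodef, h0, h1]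
  have hee : ∀ t, he (-t) = he t := fun t ↦ by simp only [hedef, neg_neg]; ring
  have hoo : ∀ t, ho (-t) = -ho t := fun t ↦ by simp only [hodef, neg_neg]; ring
  have hsum : h = he + ho := by
    funext t; simp only [hedef, hodef, Pi.add_apply]; ring
  -- `u` is odd a.e.
  have huo : ∀ᵐ t : ℝ, u (-t) = -u t :=
    ae_neg_eq_neg_of_tendsto hu
      (fun n ↦ (hg n).1.1.continuous.memLp_of_hasCompactSupport (hg n).1.2)
      (fun n ↦ (hg n).2.2.1) hL
  -- split the functional and the pairing
  have hW : ∀ n, weilFunctional (weilConv (g n) (weilReflect h)) =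
      weilFunctional (weilConv (g n) (weilReflect ho)) := fun n ↦ by
    conv_lhs => rw [hsum]
    rw [weilReflect_add, weilConv_add_right (hg n).1 het.weilReflect hot.weilReflect,
      weilFunctional_add ((hg n).1.weilConv het.weilReflect) ((hg n).1.weilConv hot.weilReflect),
      weilFunctional_weilConv_weilReflect_eq_zero_of_odd_even (hg n).2.2.1 hee, zero_add]
  have hPair : ∫ t, u t * conj (h t) = ∫ t, u t * conj (ho t) := by
    have hi : ∀ v : ℝ → ℂ, IsWeilTest v → Integrable fun t ↦ u t * conj (v t) := fun v hv ↦
      hu.integrable_mul (ConnesVanSuijlekom.memLp_conj (ConnesVanSuijlekom.isWeilTest_memLp hv))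
    have e1 : (fun t ↦ u t * conj (h t)) = fun t ↦ u t * conj (he t) + u t * conj (ho t) := by
      funext t
      rw [← mul_add, ← map_add]
      congr 2
      exact congrFun hsum t
    rw [e1, integral_add (hi he het) (hi ho hot), integral_mul_conj_eq_zero_of_ae_odd_even huo hee,
      zero_add]
  have key := oddGroundState_eulerLagrange_odd hg hQ hu hL hot hos hoo
  rw [← hPair] at key
  exact key.congr fun n ↦ (hW n).symm

/-- **Weak Euler–Lagrange equation, `IsWeilOddGroundState` form** (dot-notation extension of
the Literature predicate, declared from this Theorems file as its even twin
`IsWeilGroundState.exists_eulerLagrange` is). Every operator-free odd-sector ground state `u`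
at window `a` comes with an `L²`-normalised ODD minimising sequence `gₙ → u` in `L²`
(`Re Q(gₙ) → ε_od(a)`) along which `W(gₙ ⋆ h̃) → ε_od(a) ∫ u h̄` for EVERY window test
function `h`. [cite: Bombieri2000Weil, §4 Lemma 1 / (4.2), Thm 3 and §9 Lemma 11] -/
theorem _root_.Literature.NumberTheory.LFunctions.IsWeilOddGroundState.exists_eulerLagrange
    {a : ℝ} {u : ℝ → ℂ} (hu : IsWeilOddGroundState a u) :
    ∃ g : ℕ → ℝ → ℂ,
      (∀ n, IsWeilTest (g n) ∧ tsupport (g n) ⊆ Icc (-a) a ∧ (∀ t, g n (-t) = -g n t) ∧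
        ∫ t, ‖g n t‖ ^ 2 = (1 : ℝ)) ∧
      Tendsto (fun n => (weilQuadratic (g n)).re) atTop (𝓝 (weilOddGroundEnergy a)) ∧
      Tendsto (fun n => ∫ t, ‖g n t - u t‖ ^ 2) atTop (𝓝 0) ∧
      ∀ h : ℝ → ℂ, IsWeilTest h → tsupport h ⊆ Icc (-a) a →
        Tendsto (fun n => weilFunctional (weilConv (g n) (weilReflect h))) atTop
          (𝓝 ((weilOddGroundEnergy a : ℂ) * ∫ t, u t * conj (h t))) := by
  obtain ⟨hu2, g, hg, hQ, hL⟩ := (isWeilOddGroundState_iff_tendsto a u).1 hu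
  exact ⟨g, hg, hQ, hL, fun h hh hhs => oddGroundState_eulerLagrange hg hQ hu2 hL hh hhs⟩

end Summit.RiemannHypothesis.RiemannHypothesis.Theorems.OddSector

end
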